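import Summits.KontsevichZagierPeriods.KontsevichZagierPeriods.Theorems.HurwitzMicroSectorsNormalFormPrincipleAngLattice
import Summits.KontsevichZagierPeriods.KontsevichZagierPeriods.Theorems.AbelContractionRealHyperellipticSectorPortAngSigned
import Summits.KontsevichZagierPeriods.KontsevichZagierPeriods.Theorems.AbelContractionRealHyperellipticSectorPortAlgVanishing

/-!
# Route AbelContraction — `RealHyperellipticSector` (crux stmt-KontsevichZagierPeriods-12475):
# the dimension-certified port, layer 6 — Conjecture 1 inside dimension one for the mixed normal form

Helper file of the line `Lines/birth.lean` (stub `stub_bakerAlg`, `--supports` the crux): the port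
of `Theorems/HurwitzMicroSectorsNormalFormPrincipleAngLattice.lean` (namespace
`…NormalFormPrinciple.PiBox.Dlog`) INTO THE BUDGET `KZ.relationsLE 1`:
`nfD_eq_zero_of_eval_eq_zero` (registered sub-goal) — a class
`[pt, r] + Σ Λ(uⱼ, cⱼ) + Σ T(t_l, d_l)` of `FormalRep ⧸ relationsLE 1` (real algebraic data,
`uⱼ > 1`, `t_l ≥ 0`) with value `0` is `0`: logarithms on a multiplicative basis
(`Port.Dlog.carrierA_monomial_eq`), angles on a positive lattice basis after subdivision
(`Port.Dlog.signedAng_nsmul`, `Port.Dlog.signedAng_sum` — the tangent addition law by moves in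
dimension `1`), then Baker for logarithms and angles
(`Ang.SiegeK4.eq_zero_of_alg_logs_angles_eq_zero`, reused). Every move is among representations of
dimension `≤ 1`.

The Baker-side lemmas (`exists_mulBasis`, `exists_latticeBasis`, `isAlgebraic_exp_*`,
`isAlgebraic_tan_of_exp`, `isAlgebraic_exp_div_nat`, the values `value_pt/dlogA/angA`) are reused
from the originals.

Sources: M. Kontsevich, D. Zagier, *Periods* (2001), §1.2 Conjecture 1 [KontsevichZagier2001];
A. Baker, *Transcendental Number Theory* (1975), Thm. 2.1. No definitions are introduced.
-/

noncomputable section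

open MeasureTheory Set
open Literature.NumberTheory.Transcendental Literature.NumberTheory.Transcendental.KZ
open Literature.ModelTheory.ExponentialFields (IsSemialgebraic)
open Complex

namespace Summit.KontsevichZagierPeriods.AbelContraction.RealHyperellipticSector.Port

namespace Dlog

open Summit.KontsevichZagierPeriods.HurwitzMicroSectors.NormalFormPrinciple.PiBox (Ang.SiegeK4.eq_zero_of_alg_logs_angles_eq_zero)
open Summit.KontsevichZagierPeriods.HurwitzMicroSectors.NormalFormPrinciple.PiBox.Dlog
  (exists_mulBasis exists_latticeBasis isAlgebraic_exp_arctan_mul_I isAlgebraic_exp_sum_mul_I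
    isAlgebraic_exp_int_mul_mul_I isAlgebraic_exp_div_nat isAlgebraic_tan_of_exp
    value_pt value_dlogA value_angA)

/-- **Conjecture 1 for the mixed normal form (KZ-rigidity of `ℚ̄ + Σ ℚ̄ log ℚ̄ + Σ ℚ̄ arctan ℚ̄`).**
Let `x` be a formal combination whose class is `[pt, r] + Σⱼ Λ(uⱼ, cⱼ) + Σ_l T(t_l, d_l)` with real
algebraic `r`, `uⱼ > 1`, `cⱼ`, `t_l ≥ 0`, `d_l`, and whose value `r + Σ cⱼ log uⱼ + Σ d_l arctan t_l`
vanishes. Then `[x] = 0` in `FormalRep ⧸ relationsLE 1` (inside the budget `relationsLE 1`; registered sub-goal of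
crux stmt-KontsevichZagierPeriods-12475, port of `PiBox.Dlog.nfD_eq_zero_of_eval_eq_zero`). Proof: re-expand the `Λ(uⱼ, ·)` on a
multiplicative basis `εᵢ` of the `uⱼ` (`carrierA_monomial_eq`); re-expand the `T(t_l, ·)` on a
positive `ℤ`-basis `fᵢ` of the lattice spanned by the angles `φ_l = arctan t_l`, after subdividing by a
large `M` so that all partial sums of `φ_l / M = Σ n_{li} fᵢ/M` stay inside `(−π/2, π/2)`
(`signedAng_nsmul`, `signedAng_sum` — the tangent addition law by moves); the new tangents
`tan(fᵢ/M)` are algebraic because `e^{i fᵢ/M}` is a root of the algebraic number `Π_l e^{i m φ_l}`.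
The value becomes `r + Σ Cᵢ log εᵢ + Σ Dᵢ fᵢ/M = 0` with independent logarithms and independent
angles, so Baker (`Ang.SiegeK4.eq_zero_of_alg_logs_angles_eq_zero`) kills every coefficient.
[cite: KontsevichZagier2001, §1.2 Conjecture 1] -/
theorem nfD_eq_zero_of_eval_eq_zero : ∀ {RA : ℝ → ℝ → ℝ → KZ.IntegralRep 1} {ZA : ℝ → KZ.IntegralRep 0}
    {RG : ℝ → ℝ → KZ.IntegralRep 1},
    (∀ a b c, IsAlgebraic ℚ a → IsAlgebraic ℚ b → IsAlgebraic ℚ c → 0 < a →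
      (RA a b c).domain = {x | x 0 ∈ Set.Ioo a b} ∧ (RA a b c).integrand = fun x => c / x 0) →
    (∀ r, IsAlgebraic ℚ r → (ZA r).domain = Set.univ ∧ (ZA r).integrand = fun _ => r) →
    (∀ t d, IsAlgebraic ℚ t → IsAlgebraic ℚ d →
      (RG t d).domain = {x | x 0 ∈ Set.Ioo 0 t} ∧ (RG t d).integrand = fun x => d / (1 + x 0 ^ 2)) →
    ∀ (x : KZ.FormalRep) {r : ℝ} {k : ℕ} {u c : Fin k → ℝ} {k' : ℕ} {t d : Fin k' → ℝ},
    IsAlgebraic ℚ r → (∀ j, 1 < u j) → (∀ j, IsAlgebraic ℚ (u j)) → (∀ j, IsAlgebraic ℚ (c j)) →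
    (∀ l, 0 ≤ t l) → (∀ l, IsAlgebraic ℚ (t l)) → (∀ l, IsAlgebraic ℚ (d l)) →
    QuotientAddGroup.mk' (KZ.relationsLE 1) x = QuotientAddGroup.mk' (KZ.relationsLE 1) (KZ.of (ZA r)) +
      ∑ j, QuotientAddGroup.mk' (KZ.relationsLE 1) (KZ.of (RA 1 (u j) (c j))) +
      ∑ l, QuotientAddGroup.mk' (KZ.relationsLE 1) (KZ.of (RG (t l) (d l))) →
    KZ.eval x = 0 → QuotientAddGroup.mk' (KZ.relationsLE 1) x = 0 := by
  intro RA ZA RG hR hZ hRG x r k u c k' t d hr hu1 hu hc ht0 ht hd hx hv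
  classical
  obtain ⟨E, hEp, hEn⟩ := exists_signedAng RG
  have hπ : (2:ℝ) < Real.pi := by linarith [Real.pi_gt_three]
  -- (1) logarithms on a multiplicative basis
  obtain ⟨s, ε, n, hε1, hεA, hli, hmon⟩ := exists_mulBasis u (fun j => lt_trans one_pos (hu1 j)) hu
  have hε0 : ∀ i, 0 < ε i := fun i => lt_trans one_pos (hε1 i)
  set C : Fin s → ℝ := fun i => ∑ j, (n j i : ℝ) * c j with hC
  have hCA : ∀ i, IsAlgebraic ℚ (C i) := fun i =>
    Finset.sum_induction _ (IsAlgebraic ℚ) (fun _ _ ha hb => ha.add hb) isAlgebraic_zero fun j _ => (isAlgebraic_int (R := ℚ) (n j i)).mul (hc j)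
  have hlog : ∑ j, QuotientAddGroup.mk' (relationsLE 1) (of (RA 1 (u j) (c j))) =
      ∑ i, QuotientAddGroup.mk' (relationsLE 1) (of (RA 1 (ε i) (C i))) := by
    have h1 : ∀ j, QuotientAddGroup.mk' (relationsLE 1) (of (RA 1 (u j) (c j))) =
        ∑ i, QuotientAddGroup.mk' (relationsLE 1) (of (RA 1 (ε i) ((n j i : ℝ) * c j))) := by
      intro j
      rw [carrierA_monomial_eq hR ε hε1 hεA (n j) (hu1 j).le (hu j) (hc j) (hmon j)]
      refine Finset.sum_congr rfl fun i _ => ?_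
      rw [carrierA_zsmul_eq hR (hεA i) (hc j)]
    rw [Finset.sum_congr rfl fun j _ => h1 j, Finset.sum_comm]
    refine Finset.sum_congr rfl fun i _ => ?_
    show _ = QuotientAddGroup.mk' (relationsLE 1) (of (RA 1 (ε i) (∑ j, (n j i : ℝ) * c j)))
    rw [carrierA_sum_eq _ _ hR (hεA i) fun j _ => (isAlgebraic_int (R := ℚ) (n j i)).mul (hc j)]
  -- (2) angles on a positive lattice basis, subdivided by `M`
  obtain ⟨φ, hφ⟩ : ∃ φ : Fin k' → ℝ, ∀ l, φ l = Real.arctan (t l) := ⟨_, fun _ => rfl⟩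
  have hφ0 : ∀ l, 0 ≤ φ l := fun l => by rw [hφ l]; exact Real.arctan_nonneg.mpr (ht0 l)
  have hφlt : ∀ l, φ l < Real.pi / 2 := fun l => by rw [hφ l]; exact Real.arctan_lt_pi_div_two _
  have hφe : ∀ l, IsAlgebraic ℚ (cexp ((φ l : ℂ) * I)) := fun l => by
    rw [hφ l]; exact isAlgebraic_exp_arctan_mul_I (ht l)
  obtain ⟨s', f, nn, mm, hf0, hfli, hφf, hfφ⟩ := exists_latticeBasis φ
  obtain ⟨M, hM⟩ := exists_nat_gt (∑ l, ∑ i, |(nn l i : ℝ)| * f i + ∑ i, f i)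
  have hB0 : 0 ≤ ∑ l, ∑ i, |(nn l i : ℝ)| * f i :=
    Finset.sum_nonneg fun l _ => Finset.sum_nonneg fun i _ => mul_nonneg (abs_nonneg _) (hf0 i).le
  have hF0 : 0 ≤ ∑ i, f i := Finset.sum_nonneg fun i _ => (hf0 i).le
  have hMpos : (0:ℝ) < M := by linarith
  have hM0 : 0 < M := by exact_mod_cast hMpos
  obtain ⟨g, hg⟩ : ∃ g : Fin s' → ℝ, ∀ i, g i = f i / M := ⟨_, fun _ => rfl⟩
  have hg0 : ∀ i, 0 < g i := fun i => by rw [hg i]; exact div_pos (hf0 i) hMpos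
  have hglt : ∀ i, g i < Real.pi / 2 := by
    intro i
    have h1 : f i ≤ ∑ i, f i := Finset.single_le_sum (fun i _ => (hf0 i).le) (Finset.mem_univ i)
    have h2 : f i / M < 1 := by rw [div_lt_one hMpos]; linarith
    rw [hg i]
    linarith
  have hge : ∀ i, IsAlgebraic ℚ (cexp ((g i : ℂ) * I)) := by
    intro i
    have hfe : IsAlgebraic ℚ (cexp ((f i : ℂ) * I)) := by
      rw [hfφ i]
      exact isAlgebraic_exp_sum_mul_I _ (fun l => (mm i l : ℝ) * φ l) fun l _ =>
        isAlgebraic_exp_int_mul_mul_I (hφe l) (mm i l)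
    rw [hg i]
    exact isAlgebraic_exp_div_nat hfe hM0
  have hτA : ∀ i, IsAlgebraic ℚ (Real.tan (g i)) := fun i => isAlgebraic_tan_of_exp (hge i)
  have hτ0 : ∀ i, 0 ≤ Real.tan (g i) := fun i =>
    Real.tan_nonneg_of_nonneg_of_le_pi_div_two (hg0 i).le (hglt i).le
  set D : Fin s' → ℝ := fun i => ∑ l, (((M:ℤ) * nn l i : ℤ) : ℝ) * d l with hD
  have hDA : ∀ i, IsAlgebraic ℚ (D i) := fun i =>
    Finset.sum_induction _ (IsAlgebraic ℚ) (fun _ _ ha hb => ha.add hb) isAlgebraic_zero fun l _ => (isAlgebraic_int (R := ℚ) ((M:ℤ) * nn l i)).mul (hd l)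
  have hang1 : ∀ l, QuotientAddGroup.mk' (relationsLE 1) (of (RG (t l) (d l))) =
      ∑ i, QuotientAddGroup.mk' (relationsLE 1)
        (of (RG (Real.tan (g i)) ((((M:ℤ) * nn l i : ℤ) : ℝ) * d l))) := by
    intro l
    have hbl : ∑ i, |(nn l i : ℝ)| * |g i| < Real.pi / 2 := by
      have e : ∑ i, |(nn l i : ℝ)| * |g i| = (∑ i, |(nn l i : ℝ)| * f i) / M := by
        rw [Finset.sum_div]
        refine Finset.sum_congr rfl fun i _ => ?_
        rw [hg i, abs_of_pos (div_pos (hf0 i) hMpos), mul_div_assoc]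
      have h1 : ∑ i, |(nn l i : ℝ)| * f i ≤ ∑ l, ∑ i, |(nn l i : ℝ)| * f i :=
        Finset.single_le_sum (f := fun l => ∑ i, |(nn l i : ℝ)| * f i)
          (fun l _ => Finset.sum_nonneg fun i _ => mul_nonneg (abs_nonneg _) (hf0 i).le)
          (Finset.mem_univ l)
      have h2 : (∑ i, |(nn l i : ℝ)| * f i) / M < 1 := by rw [div_lt_one hMpos]; linarith
      rw [e]
      linarith
    have e1 : QuotientAddGroup.mk' (relationsLE 1) (of (RG (t l) (d l))) = E (φ l) (d l) := by
      rw [hEp _ _ (hφ0 l), hφ l, Real.tan_arctan]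
    have e2 : E (φ l) (d l) = M • E (φ l / M) (d l) := by
      have h := signedAng_nsmul hRG hEp hEn (θ := φ l / M) (isAlgebraic_exp_div_nat (hφe l) hM0) (hd l)
        M (by rw [abs_of_nonneg (div_nonneg (hφ0 l) hMpos.le), mul_div_cancel₀ _ hMpos.ne']; exact hφlt l)
      rwa [mul_div_cancel₀ _ hMpos.ne'] at h
    have e3 : φ l / M = ∑ i, (nn l i : ℝ) * g i := by
      rw [hφf l, Finset.sum_div]
      refine Finset.sum_congr rfl fun i _ => ?_
      rw [hg i, mul_div_assoc]
    have e4 : E (φ l / M) (d l) = ∑ i, nn l i • E (g i) (d l) := by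
      rw [e3]
      exact signedAng_sum hRG hEp hEn _ g (nn l) (hd l) (fun i _ => hge i)
        (fun i _ => by rw [abs_of_pos (hg0 i)]; exact hglt i) hbl
    rw [e1, e2, e4, Finset.smul_sum]
    refine Finset.sum_congr rfl fun i _ => ?_
    rw [hEp _ _ (hg0 i).le, ← natCast_zsmul, smul_smul, ang_zsmul_eq hRG (hτA i) (hd l)]
  have hang : ∑ l, QuotientAddGroup.mk' (relationsLE 1) (of (RG (t l) (d l))) =
      ∑ i, QuotientAddGroup.mk' (relationsLE 1) (of (RG (Real.tan (g i)) (D i))) := by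
    rw [Finset.sum_congr rfl fun l _ => hang1 l, Finset.sum_comm]
    refine Finset.sum_congr rfl fun i _ => ?_
    show _ = QuotientAddGroup.mk' (relationsLE 1)
      (of (RG (Real.tan (g i)) (∑ l, (((M:ℤ) * nn l i : ℤ) : ℝ) * d l)))
    rw [ang_sum_eq _ _ hRG (hτA i) fun l _ => (isAlgebraic_int (R := ℚ) ((M:ℤ) * nn l i)).mul (hd l)]
  -- (3) the re-expanded class and its value
  have hclass : QuotientAddGroup.mk' (relationsLE 1) x = QuotientAddGroup.mk' (relationsLE 1) (of (ZA r)) +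
      ∑ i, QuotientAddGroup.mk' (relationsLE 1) (of (RA 1 (ε i) (C i))) +
      ∑ i, QuotientAddGroup.mk' (relationsLE 1) (of (RG (Real.tan (g i)) (D i))) := by
    rw [hx, hlog, hang]
  have hrep : x - (of (ZA r) + ∑ i, of (RA 1 (ε i) (C i)) + ∑ i, of (RG (Real.tan (g i)) (D i))) ∈
      relationsLE 1 := by
    rw [← QuotientAddGroup.eq_zero_iff]
    change QuotientAddGroup.mk' (relationsLE 1) _ = 0
    rw [map_sub, map_add, map_add, map_sum, map_sum, hclass, sub_self]
  have hval : r + ∑ i, C i * Real.log (ε i) + ∑ i, D i * g i = 0 := by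
    have h := Budget.eval_eq_zero_of_mem_relationsLE hrep
    rw [map_sub, hv, zero_sub, neg_eq_zero, map_add, map_add, map_sum, map_sum]
      at h
    rw [← h, eval_of, value_pt (ZA r) (hZ r hr).1 (hZ r hr).2]
    congr 1
    · congr 1
      refine Finset.sum_congr rfl fun i _ => ?_
      have hRi := hR 1 (ε i) (C i) isAlgebraic_one (hεA i) (hCA i) one_pos
      have hEqOn : EqOn (RA 1 (ε i) (C i)).integrand (fun x => C i / x 0) (RA 1 (ε i) (C i)).domain := by
        rw [hRi.2]; exact fun _ _ => rfl
      rw [eval_of, value_dlogA (RA 1 (ε i) (C i)) hRi.1 hEqOn one_pos (hε1 i).le, div_one]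
    · refine Finset.sum_congr rfl fun i _ => ?_
      have hRi := hRG (Real.tan (g i)) (D i) (hτA i) (hDA i)
      rw [eval_of, value_angA (RG _ _) hRi.1 (by rw [hRi.2]; exact fun _ _ => rfl) (hτ0 i),
        Real.arctan_tan (by linarith [hg0 i]) (hglt i), Real.arctan_zero, sub_zero]
  -- (4) Baker: all coefficients vanish
  have hgli : LinearIndependent ℚ g := by
    have hMq : (M:ℚ)⁻¹ ≠ 0 := inv_ne_zero (by exact_mod_cast hM0.ne')
    have h := hfli.units_smul fun _ => Units.mk0 _ hMq
    convert h using 1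
    funext i
    rw [Pi.smul_apply', Units.smul_def, Units.val_mk0, Rat.smul_def, Rat.cast_inv, Rat.cast_natCast,
      hg i, div_eq_inv_mul]
  obtain ⟨hr0, hC0, hD0⟩ :=
    Ang.SiegeK4.eq_zero_of_alg_logs_angles_eq_zero ε hε0 hεA hli g hge hgli r hr C hCA D hDA hval
  rw [hclass, hr0]
  have hZ0 : QuotientAddGroup.mk' (relationsLE 1) (of (ZA 0)) = 0 :=
    (QuotientAddGroup.eq_zero_iff _).mpr (pt_zero_mem_relationsLE (ZA 0) (hZ 0 isAlgebraic_zero).2)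
  have h1 : ∑ i, QuotientAddGroup.mk' (relationsLE 1) (of (RA 1 (ε i) (C i))) = 0 := by
    refine Finset.sum_eq_zero fun i _ => ?_
    rw [hC0 i]
    exact (QuotientAddGroup.eq_zero_iff _).mpr (carrierA_zero_mem_relationsLE hR (hεA i))
  have h2 : ∑ i, QuotientAddGroup.mk' (relationsLE 1) (of (RG (Real.tan (g i)) (D i))) = 0 := by
    refine Finset.sum_eq_zero fun i _ => ?_
    rw [hD0 i]
    exact (QuotientAddGroup.eq_zero_iff _).mpr (ang_zero_mem_relationsLE hRG (hτA i))
  rw [hZ0, zero_add, h1, h2, add_zero]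

end Dlog


end Summit.KontsevichZagierPeriods.AbelContraction.RealHyperellipticSector.Port

end
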